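import Summits.AnomalousDissipation.AnomalousDissipation.Theorems.IsotropicCubatureWord
import HarnessLib

/-!
# K1L_D `stub_D1_V0thg` (stmt-AnomalousDissipation-27980), R3′ lane «SidebandTailCrushing» — the PATH-CLASS CENSUS of the cubature word
# (tenure D28-20 (1): «cheapest falsifier, run it first»; `--supports stmt-AnomalousDissipation-27980 --as helper`)

Helper file of route `SolenoidalFractalHomogenisation` (prover seat `ad-k1l-cellLawV-w1` g10; plan memo
`Cruxes/LagrangianRenormalisationStepDesign/Lines/onelevel-vtheta-R3-plan.md` §2).  A finite, `decide`d statement about the integer data `slots : Fin 26 → SlotData`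
of `IsotropicCubatureWord` (slot `j` plays direction `m_j` with polarisation numerator `v_j ⊥ m_j`; the slots are replayed cyclically in index order).

Memory deposited by source slot `j′` sits on the fibres `±m_{j′}`; during a later slot `i` it is STATIC iff `v_i · m_{j′} = 0` (the link coefficient along its
ladder is `2πi(ê_i·z)·env`, `ê_i = v_i/√n_i`), else it is HOPPED (and then crushed by the enhanced dissipation of file F4).  Pickup slot `j` reads the fibres `±m_j`.
The census says that every ordered pair (pickup `j`, source `j′`) is in one of the classes of the memo's table:
* (C1) `own_wraparound_hops` — for every `j′` some slot `i ≠ j′` hops `m_{j′}` (so the own-slot memory of an EARLIER period and every `k ≥ 1`-periods-old path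
  is crushed; the same-period own-slot term is the exact ν-free `excQS`);
* (C2) `pair_census` — for `j ≠ j′`, going forward cyclically from `j′` to the next occurrence of `j`: EITHER some strictly intermediate slot hops `m_{j′}` (CRUSHED),
  OR `m_j ∦ m_{j′}` (`m_j × m_{j′} ≠ 0`: the static memory never meets the reading fibres — class ZERO), OR `(j′, j) = (2c, 2c+1)` is a partner pair (static
  adjacent colinear read — the ν-free `pairQS`).  In particular there is NO static non-adjacent colinear class: `Ψ_∞ = excQS + pairQS` for this word (D28-16 (2)).
Pure `decide` over `ℤ`; no definition, no sorry.  NOT a proof of `stub_D1_V0thg`, of K1L_D or of AD; rung F-D1.A0 infrastructure.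
-/

set_option linter.dupNamespace false -- single-conjunct summit: `Summit.AnomalousDissipation.AnomalousDissipation.…` is the mandated namespace

namespace Summit.AnomalousDissipation.AnomalousDissipation.Theorems.SolenoidalFractalHomogenisation.LagrangianStep.LadderCrush

open Summit.AnomalousDissipation.AnomalousDissipation.Theorems (slots SlotData)

/-- **(C1) Every direction is hopped by some other slot**: `∀ j′, ∃ i ≠ j′, v_i · m_{j′} ≠ 0` (indeed one of the axis slots 0–5 always does).
[cite: MeshalkinSinai1961, pp. 1700–1705] -/
theorem own_wraparound_hops :
    ∀ j' : Fin 26, ∃ i : Fin 26, i ≠ j' ∧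
      (slots i).v 0 * (slots j').m 0 + (slots i).v 1 * (slots j').m 1 + (slots i).v 2 * (slots j').m 2 ≠ 0 := by
  decide

/-- **(C2) The pair census**: for `j ≠ j′`, either a slot strictly between `j′` and the next occurrence of `j` (cyclically) hops `m_{j′}`, or `m_j × m_{j′} ≠ 0`
(class ZERO), or `(j′, j)` is a partner pair `(2c, 2c+1)` (class `pairQS`). [cite: MeshalkinSinai1961, pp. 1700–1705] -/
theorem pair_census :
    ∀ j' j : Fin 26, j ≠ j' →
      (∃ i : Fin 26, ((j' < i ∧ i < j) ∨ (j ≤ j' ∧ (j' < i ∨ i < j))) ∧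
          (slots i).v 0 * (slots j').m 0 + (slots i).v 1 * (slots j').m 1 + (slots i).v 2 * (slots j').m 2 ≠ 0) ∨
      ((slots j).m 1 * (slots j').m 2 - (slots j).m 2 * (slots j').m 1 ≠ 0 ∨
        (slots j).m 2 * (slots j').m 0 - (slots j).m 0 * (slots j').m 2 ≠ 0 ∨
        (slots j).m 0 * (slots j').m 1 - (slots j).m 1 * (slots j').m 0 ≠ 0) ∨
      ((j' : ℕ) % 2 = 0 ∧ (j : ℕ) = (j' : ℕ) + 1) := by
  decide

end Summit.AnomalousDissipation.AnomalousDissipation.Theorems.SolenoidalFractalHomogenisation.LagrangianStep.LadderCrush
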